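import Summits.ResolutionOfSingularities.ResolutionOfSingularities.Theorems.HilbertSamuelEliminationSigmaMaxModificationsCorridor3RegularValue
import Summits.ResolutionOfSingularities.ResolutionOfSingularities.Theorems.HilbertSamuelEliminationSigmaMaxModificationsCorridor3WLadderStrataScope
import HarnessLib

/-!
# [OURS · L1 W4.2] Row (D) `Moving.MaxOriginMovingNondegenerate` CLOSED: a maximal origin carrying a moving chain has `ν ≠ Φ^{(N)}`
# (crux `SigmaMaxModifications` stmt-ResolutionOfSingularities-18506; conjunct `SigmaMaxModificationsCorridor3` stmt-…-19249; line `w_ladder` v6)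

Stub worker res-L1-w42-stub-1 (gen 3). Helper file `--supports stmt-ResolutionOfSingularities-19249 --as helper`; kernel only, no named
fact, no new definition. Closes BY NAME stub-4's open row (D) of `…Corridor3WLadderStrataScope` (p504439) — «maximal origin + MOVING chain
⇒ `ν ≠ iterPSum N Phi`» — from this seat's regular-value lemma `IsMaximalOrigin.noNearChainFrom_of_eq_iterPSum` (`…Corridor3RegularValue`,
p504161: at the regular value there is no infinite near chain at all, moving or not, for every admissible oracle). With it stub-4's
`maxOriginNoMovingNearChainAtQ_of_qNe` / `…Recurrent…_of_qNe` / `…At_of_qNe` become unconditional: every moving row may be proved under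
`ν ≠ Φ^{(N)}` (`Moving.QNe`). OURS bookkeeping; NOT a statement of the manuscript [Hironaka2017] nor of [CossartJannsenSaito2020].
AI-written; AI review is weaker than expert review.

References: V. Cossart, U. Jannsen, S. Saito, LNM 2270 (2020), Lemma 2.31, Rem. 2.32, Rem. 6.29 (1) [CossartJannsenSaito2020].
-/

noncomputable section

set_option linter.dupNamespace false -- mandated namespace of this single-conjunct summit

open CategoryTheory AlgebraicGeometry TopologicalSpace

namespace Summit.ResolutionOfSingularities.ResolutionOfSingularities.Theorems.SigmaMaxModificationsCorridor3.Moving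

open Literature.AlgebraicGeometry.Resolution Literature.RingTheory.HilbertSamuel
open Summit.ResolutionOfSingularities.ResolutionOfSingularities.Theorems.CampaignW42

universe u

/-- **Row (D) holds: a maximal origin carrying a MOVING chain of canonical near steps has `ν ≠ Φ^{(N)}`** (indeed one carrying
any infinite chain does: `IsMaximalOrigin.noNearChainFrom_of_eq_iterPSum`). [cite: CossartJannsenSaito2020, Lemma 2.31, Rem. 6.29 (1)] -/
theorem maxOriginMovingNondegenerate (p N : ℕ) : MaxOriginMovingNondegenerate.{u} p N := by
  intro R _ hRa ν X _ x hX c h0 hstep _ hν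
  exact hX.noNearChainFrom_of_eq_iterPSum hRa hν (fun _ => True) ⟨c, h0, hstep, fun _ => trivial⟩

/-- **Every moving row may be proved under `ν ≠ Φ^{(N)}`** (stub-4's `maxOriginNoMovingNearChainAtQ_of_qNe` with (D) discharged).
[folklore] -/
theorem maxOriginNoMovingNearChainAtQ_of_qNe' {p N : ℕ} {Q : ℕ → (ℕ → ℕ) → ∀ X : Scheme.{u}, X → Prop}
    {G : MarkedStage.{u} → Prop} (h : MaxOriginNoMovingNearChainAtQ p N (QNe Q) G) : MaxOriginNoMovingNearChainAtQ p N Q G :=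
  maxOriginNoMovingNearChainAtQ_of_qNe (maxOriginMovingNondegenerate p N) h

/-- … the same for the moving-recurrent rows. [folklore] -/
theorem maxOriginNoMovingRecurrentNearChainAtQ_of_qNe' {p N : ℕ} {Q : ℕ → (ℕ → ℕ) → ∀ X : Scheme.{u}, X → Prop}
    {G B : MarkedStage.{u} → Prop} (h : MaxOriginNoMovingRecurrentNearChainAtQ p N (QNe Q) G B) :
    MaxOriginNoMovingRecurrentNearChainAtQ p N Q G B :=
  maxOriginNoMovingRecurrentNearChainAtQ_of_qNe (maxOriginMovingNondegenerate p N) h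

/-- … and for the unrestricted rows. [folklore] -/
theorem maxOriginNoMovingNearChainAt_of_qNe' {p N : ℕ} {G : MarkedStage.{u} → Prop}
    (h : MaxOriginNoMovingNearChainAtQ p N (QNe fun _ _ _ _ => True) G) : MaxOriginNoMovingNearChainAt p N G :=
  maxOriginNoMovingNearChainAt_of_qNe (maxOriginMovingNondegenerate p N) h

end Summit.ResolutionOfSingularities.ResolutionOfSingularities.Theorems.SigmaMaxModificationsCorridor3.Moving

end
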